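import Mathlib

/-!
# The two-Jordan-block automorphism `J₂ ⊕ J₂` has order `p` (programme T of chain w45c, stub S1)

(crux stmt-ResolutionOfSingularities-15640 `WildQuotients.WildQuotientResolution`, line `Sketch`,
programme «INSTANTIATE T1» = `𝔸⁴/(J₂ ⊕ J₂)`; candidate stub S1 `stub_twoBlocks_order` of
`L/w45c/W45cPlanSignaturesV2.lean` (plan-1), signature verbatim; [OURS · L1 W4.5c] — NOT a
statement of any manuscript.)

For the `k`-algebra automorphism `σ` of `k[x₀,x₁,x₂,x₃]` with `σ x₀ = x₀`, `σ x₁ = x₁ + x₀`,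
`σ x₂ = x₂`, `σ x₃ = x₃ + x₂` over a field of characteristic `p` (ANY prime `p`): the iterates are
`σⁿ x₁ = x₁ + n x₀`, `σⁿ x₃ = x₃ + n x₂` (`twoBlocks_pow_apply_X`), so `σ ^ p = 1`; `σ ≠ 1`; hence
`Subgroup.zpowers σ` has exactly `p` elements (`stub_twoBlocks_order`). Model: `JordanBlock.jordanBlock_order`.
-/

-- single-problem summit: the doubled namespace component `ResolutionOfSingularities` is forced
set_option linter.dupNamespace false

noncomputable section

open MvPolynomial

namespace Summit.ResolutionOfSingularities.ResolutionOfSingularities.Theorems.WildQuotientResolution.TwoBlocks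

/-- **Iterates of `J₂ ⊕ J₂` on the coordinates**: `σⁿ x₀ = x₀`, `σⁿ x₁ = x₁ + n x₀`, `σⁿ x₂ = x₂`,
`σⁿ x₃ = x₃ + n x₂`. [folklore] -/
theorem twoBlocks_pow_apply_X (k : Type) [Field k]
    (σ : MvPolynomial (Fin 4) k ≃ₐ[k] MvPolynomial (Fin 4) k)
    (h0 : σ (X 0) = X 0) (h1 : σ (X 1) = X 1 + X 0)
    (h2 : σ (X 2) = X 2) (h3 : σ (X 3) = X 3 + X 2) (n : ℕ) :
    (σ ^ n) (X 0) = X 0 ∧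
    (σ ^ n) (X 1) = X 1 + (n : MvPolynomial (Fin 4) k) * X 0 ∧
    (σ ^ n) (X 2) = X 2 ∧
    (σ ^ n) (X 3) = X 3 + (n : MvPolynomial (Fin 4) k) * X 2 := by
  induction n with
  | zero =>
    refine ⟨?_, ?_, ?_, ?_⟩ <;> simp
  | succ n ih =>
    obtain ⟨e0, e1, e2, e3⟩ := ih
    refine ⟨?_, ?_, ?_, ?_⟩
    · rw [pow_succ', AlgEquiv.mul_apply, e0, h0]
    · rw [pow_succ', AlgEquiv.mul_apply, e1, map_add, map_mul, map_natCast, h0, h1]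
      push_cast
      ring
    · rw [pow_succ', AlgEquiv.mul_apply, e2, h2]
    · rw [pow_succ', AlgEquiv.mul_apply, e3, map_add, map_mul, map_natCast, h2, h3]
      push_cast
      ring

/-- STUB S1 `stub_twoBlocks_order` (S, classical; model `JordanBlock.jordanBlock_order`): the
two-block unipotent automorphism `σ = J₂ ⊕ J₂` of `k[x₀,…,x₃]` (`σ x₁ = x₁ + x₀`, `σ x₃ = x₃ + x₂`,
`x₀, x₂` fixed) over a field of characteristic `p` has order `p` in EVERY characteristic `p`:
`σ ^ p = 1` (since `σⁿ x₁ = x₁ + n x₀`, `σⁿ x₃ = x₃ + n x₂` and `p = 0` in `k`), `σ ≠ 1`, and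
`Subgroup.zpowers σ` has exactly `p` elements. [folklore] -/
theorem stub_twoBlocks_order (p : ℕ) (hp : p.Prime) (k : Type) [Field k] [CharP k p]
    (σ : MvPolynomial (Fin 4) k ≃ₐ[k] MvPolynomial (Fin 4) k)
    (h0 : σ (X 0) = X 0) (h1 : σ (X 1) = X 1 + X 0)
    (h2 : σ (X 2) = X 2) (h3 : σ (X 3) = X 3 + X 2) :
    σ ^ p = 1 ∧ σ ≠ 1 ∧ Nat.card (Subgroup.zpowers σ) = p := by
  classical
  haveI : Fact p.Prime := ⟨hp⟩
  obtain ⟨e0, e1, e2, e3⟩ := twoBlocks_pow_apply_X k σ h0 h1 h2 h3 p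
  have hp0 : (p : MvPolynomial (Fin 4) k) = 0 := CharP.cast_eq_zero _ p
  rw [hp0, zero_mul, add_zero] at e1 e3
  -- `σ ^ p = 1`: check on the generators
  have hpow : σ ^ p = 1 := by
    have key : ((σ ^ p : MvPolynomial (Fin 4) k ≃ₐ[k] MvPolynomial (Fin 4) k) :
        MvPolynomial (Fin 4) k →ₐ[k] MvPolynomial (Fin 4) k) = AlgHom.id k _ := by
      refine MvPolynomial.algHom_ext fun i => ?_
      change (σ ^ p) (X i) = X i
      match i with
      | 0 => exact e0
      | 1 => exact e1
      | 2 => exact e2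
      | 3 => exact e3
    apply AlgEquiv.ext
    intro a
    have := DFunLike.congr_fun key a
    simpa using this
  -- `σ ≠ 1`: `σ x₁ = x₁ + x₀ ≠ x₁`
  have hne : σ ≠ 1 := by
    intro h
    have h1' := h1
    rw [h, AlgEquiv.one_apply] at h1'
    have hX0 : (X 0 : MvPolynomial (Fin 4) k) = 0 := by
      have := congrArg (fun f => f - X 1) h1'
      simp only [sub_self, add_sub_cancel_left] at this
      exact this.symm
    exact MvPolynomial.X_ne_zero _ hX0
  refine ⟨hpow, hne, ?_⟩
  rw [Nat.card_zpowers, orderOf_eq_prime hpow hne]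

end Summit.ResolutionOfSingularities.ResolutionOfSingularities.Theorems.WildQuotientResolution.TwoBlocks

end
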